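import Mathlib
import Literature.AlgebraicGeometry.Resolution.FormalFibresInseparable
import Literature.AlgebraicGeometry.Resolution.RegularCentreLocal

/-!
# TropicalLinks / InductiveStep — brick B7: a Laurent polynomial ring is regular at every prime
# iff its coefficient ring is

Route `ResolutionOfSingularities/TropicalLinks`, crux `InductiveStep` (stmt-ResolutionOfSingularities-17233),
line `split`, brick B7 of the Gröbner dictionary in support of stub `stub_sncClosureSchon`.  Brick B4
(`TropicalLinksInductiveStepRayDegeneration.lean`) identifies the initial degeneration of an ideal of
the split torus along the coordinate ray `e₁` with a LAURENT POLYNOMIAL RING over the coordinate ring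
of the special fibre of the partial compactification, `k[ℤ × L] ⧸ in_{e₁}(J) ≃ₐ[k] (k[L] ⧸ 𝔣)[ℤ]`.  To
read "degeneration regular ⟺ fibre regular" off this isomorphism one needs the present brick.

**Statement** (`tropicalLinks_forall_prime_regular_laurent_iff`).  Let `A` be a commutative ring whose
Laurent polynomial ring `A[ℤ] = AddMonoidAlgebra A ℤ` (Mathlib's `LaurentPolynomial A`, an `abbrev`)
is Noetherian.  Then every localization of `A[ℤ]` at a prime ideal is a regular local ring iff every
localization of `A` at a prime ideal is a regular local ring.

**Proof.**  `A` is a quotient of `A[ℤ]` (evaluation `T ↦ 1`, `LaurentPolynomial.eval₂`), hence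
Noetherian, so both clauses are the Mathlib predicate `IsRegularRing` (`isRegularRing_iff`).
(⇒) `A[ℤ]` is a free `A`-module (on the monomials `T^n`), hence faithfully flat as soon as `A ≠ 0`
(for `A = 0` there are no primes), and regularity descends along faithfully flat ring maps with
Noetherian source — Stacks 07NG, in the tree as `isRegularRing_of_faithfullyFlat`
(`Literature/…/Resolution/FormalFibresInseparable.lean`, from Matsumura Thm. 23.7 (i)).
(⇐) `A` regular ⟹ `A[X]` regular (Mathlib, `Polynomial.isRegularRing_of_isRegularRing`) ⟹ its
localization `A[T;T⁻¹] = A[X][X⁻¹]` (`LaurentPolynomial.isLocalization`) is regular — localizations of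
regular rings are regular, tree lemma `isRegularRing_of_isLocalization`
(`Literature/…/Resolution/RegularCentreLocal.lean`).

No new definitions.
-/

set_option linter.dupNamespace false -- single-conjunct summit: doubled namespace component is mandated

namespace Summit.ResolutionOfSingularities.ResolutionOfSingularities.Theorems

open Literature.AlgebraicGeometry.Resolution

/-- **The coefficient ring is a quotient of the Laurent polynomial ring**: evaluation at `T = 1`,
`A[T;T⁻¹] →+* A`, is surjective; in particular `A` is Noetherian if `A[ℤ]` is. [folklore] -/
theorem tropicalLinks_isNoetherianRing_of_laurent (A : Type) [CommRing A]
    [IsNoetherianRing (AddMonoidAlgebra A ℤ)] : IsNoetherianRing A :=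
  isNoetherianRing_of_surjective (AddMonoidAlgebra A ℤ) A (LaurentPolynomial.eval₂ (RingHom.id A) 1)
    fun a => ⟨LaurentPolynomial.C a, LaurentPolynomial.eval₂_C _ _ a⟩

/-- **Ascent**: if `A` is a regular ring then so is the Laurent polynomial ring `A[ℤ] = A[X][X⁻¹]`
(polynomial rings over regular rings are regular, and localizations of regular rings are regular).
[folklore] -/
theorem tropicalLinks_isRegularRing_laurent (A : Type) [CommRing A] [IsRegularRing A] :
    IsRegularRing (AddMonoidAlgebra A ℤ) :=
  isRegularRing_of_isLocalization (Submonoid.powers (Polynomial.X : Polynomial A))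
    (LaurentPolynomial A)

/-- **Descent**: if the Laurent polynomial ring `A[ℤ]` is a regular ring then so is `A` — `A[ℤ]` is a
free, hence (for `A ≠ 0`) faithfully flat, `A`-algebra, and regularity descends along faithfully flat
maps (Stacks 07NG). [folklore] -/
theorem tropicalLinks_isRegularRing_of_laurent (A : Type) [CommRing A]
    [IsRegularRing (AddMonoidAlgebra A ℤ)] : IsRegularRing A := by
  haveI : IsNoetherianRing A := tropicalLinks_isNoetherianRing_of_laurent A
  rcases subsingleton_or_nontrivial A with hA | hA
  · exact isRegularRing_iff.mpr fun P hP =>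
      absurd (Ideal.eq_top_iff_one _ |>.mpr (by rw [Subsingleton.elim (1 : A) 0]; exact P.zero_mem))
        hP.ne_top
  · exact isRegularRing_of_faithfullyFlat A (AddMonoidAlgebra A ℤ)

/-- **Brick B7** (Gröbner dictionary for `stub_sncClosureSchon`): for a commutative ring `A` with
Noetherian Laurent polynomial ring `A[ℤ] = AddMonoidAlgebra A ℤ`, every localization of `A[ℤ]` at a
prime is a regular local ring iff every localization of `A` at a prime is a regular local ring.
(⇒) faithfully flat descent (Stacks 07NG); (⇐) `A[X]` is regular and `A[ℤ]` is its localization at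
the powers of `X`. [folklore] -/
theorem tropicalLinks_forall_prime_regular_laurent_iff : ∀ (A : Type) [CommRing A],
    IsNoetherianRing (AddMonoidAlgebra A ℤ) →
    ((∀ (P : Ideal (AddMonoidAlgebra A ℤ)) [P.IsPrime], IsRegularLocalRing (Localization.AtPrime P)) ↔
      ∀ (P : Ideal A) [P.IsPrime], IsRegularLocalRing (Localization.AtPrime P)) := by
  intro A _ hN
  haveI : IsNoetherianRing A := tropicalLinks_isNoetherianRing_of_laurent A
  constructor
  · intro h
    haveI : IsRegularRing (AddMonoidAlgebra A ℤ) := isRegularRing_iff.mpr h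
    haveI : IsRegularRing A := tropicalLinks_isRegularRing_of_laurent A
    exact isRegularRing_iff.mp this
  · intro h
    haveI : IsRegularRing A := isRegularRing_iff.mpr h
    haveI : IsRegularRing (AddMonoidAlgebra A ℤ) := tropicalLinks_isRegularRing_laurent A
    exact isRegularRing_iff.mp this

end Summit.ResolutionOfSingularities.ResolutionOfSingularities.Theorems
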